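import Summits.ValiantsHypothesis.ValiantsHypothesis.Theorems.BarrierLeverPartitionMinorsChowEdgeStep
import Summits.ValiantsHypothesis.ValiantsHypothesis.Theorems.BarrierLeverPartitionMinorsChowLeafCoreEngine

/-!
# Route BarrierLever — Chow witnesses for partition minors (item 20172, CPM): the EDGE-CORE ENGINE
# (locked ∧ unpeelable ∧ no leaf step ∧ no edge step)

Helper file (`--supports stmt-ValiantsHypothesis-20172`; cell valiant-natproofs, rung V4, 𝒟-side of
door (c); seat val-np-p4 gen 13).  Closes NO item.  Conventions of items 19717 / 20172 / 20195: a
layout `(u, w)` of height `h` (`u w : Fin r → Finset (Fin h)`) is HIT when some product of `h + h`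
affine forms has nonsingular partition minor `det[coeff_{E (u i) (w j)} ∏ ℓ]`.

`chow_hit_of_edgeCore` — **if every EDGE-CORE layout is hit then every injective layout is hit**,
where an edge-core layout is a leaf-core layout (`chow_hit_of_leafCore`: injective, LOCKED,
UNPEELABLE, `r ≥ h + 1`, no leaf step on either side) that moreover admits NO EDGE STEP
(`chow_edgeStep`, file `…ChowEdgeStep`): there is no pair of coordinates `(a, c)` such that `a`
carries EXACTLY ONE edge among the rows (`u i₀ = (u i₁).erase a`, `i₁ ≠ i₀`, and the `a`-erasure
is injective off `i₁`) and `c` carries exactly one edge among the columns.  In words: a minimal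
layout missed by all products of `h + h` affine forms, if any, has — besides being locked and
unpeelable — on at least one side NO coordinate with exactly one edge (every coordinate of that side
carries `0` or `≥ 2` edges).

Proof: the induction on the size bound of `chow_hit_of_leafCore_le`, run once more through
val-np-p4 g12's `chow_hit_of_core_le` with the edge step tried before the leaf steps; the reduced
layout of an edge step is injective (`preimage_succAbove_injective_of_injOn` on both sides) and one
size smaller, hence hit by the induction hypothesis.

`exists_edgeCore_of_not_hit` — the contrapositive.

Census (kit, exact, reported on the cell bus; cores = locked pairs with an unpeelable canonical side,
val-np-p4 g12's j279467 universe): `(h, r) = (4, 5)`: `6 400 → 320` survivors; `(4, 6)`: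
`31 952 → 6 512`; `(4, 7)`: `21 600 → 21 600` (the six «two squares» row classes carry two edges in
every direction); `(5, 6)`: see the bus line (kit j281461).

WHAT THIS IS NOT: an organising principle (reduction), not a hit; the surviving edge-cores (e.g. star
rows against an EDGELESS column family, or against a padded sub-cube) are untouched; nothing on items
20172 / 20195 / 19717 themselves, on crux stmt-ValiantsHypothesis-14610, or on `VP` versus `VNP`.
-/

set_option linter.dupNamespace false

namespace Summit.ValiantsHypothesis.ValiantsHypothesis.Theorems.BarrierLever.ChowFactor

open Finset MvPolynomial

noncomputable section

/-- **EDGE-CORE ENGINE (bounded form).**  If every injective layout that is locked, unpeelable, of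
size `r ≥ h + 1`, admits no leaf step on either side and no edge step is hit, then every injective
layout of size `r ≤ R` is hit. -/
theorem chow_hit_of_edgeCore_le
    (core : ∀ (h r : ℕ) (u w : Fin r → Finset (Fin h)), Function.Injective u → Function.Injective w →
      (∀ (a c : Fin h) (β γ : Bool),
        (Finset.univ.filter fun i => (a ∈ u i ↔ β = true)).card ≠
          (Finset.univ.filter fun j => (c ∈ w j ↔ γ = true)).card) →
      (∀ a c : Fin h, ¬ (Function.Injective (fun i => (u i).erase a) ∧
        Function.Injective (fun j => (w j).erase c))) →
      h + 1 ≤ r →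
      (∀ (a c : Fin h) (i₁ j₁ j₀ : Fin r), (∀ i, i ≠ i₁ → (a ∈ u i ↔ a ∉ u i₁)) → j₁ ≠ j₀ →
        w j₀ = (w j₁).erase c → ¬ Set.InjOn (fun j => (w j).erase c) {j | j ≠ j₁}) →
      (∀ (c a : Fin h) (j₁ i₁ i₀ : Fin r), (∀ j, j ≠ j₁ → (c ∈ w j ↔ c ∉ w j₁)) → i₁ ≠ i₀ →
        u i₀ = (u i₁).erase a → ¬ Set.InjOn (fun i => (u i).erase a) {i | i ≠ i₁}) →
      (∀ (a c : Fin h) (i₁ i₀ j₁ j₀ : Fin r), i₁ ≠ i₀ → u i₀ = (u i₁).erase a → j₁ ≠ j₀ →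
        w j₀ = (w j₁).erase c → ¬ (Set.InjOn (fun i => (u i).erase a) {i | i ≠ i₁} ∧
          Set.InjOn (fun j => (w j).erase c) {j | j ≠ j₁})) →
      ∃ ℓ : Fin (h + h) → MvPolynomial (Fin (h + h)) ℂ, (∀ q, (ℓ q).totalDegree ≤ 1) ∧
        (Matrix.of fun i j : Fin r => coeff
          (∑ b ∈ u i, Finsupp.single (Fin.castAdd h b) 1 + ∑ d ∈ w j, Finsupp.single (Fin.natAdd h d) 1)
          (∏ q, ℓ q)).det ≠ 0)
    (R : ℕ) : ∀ (h r : ℕ), r ≤ R → ∀ (u w : Fin r → Finset (Fin h)), Function.Injective u →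
      Function.Injective w →
      ∃ ℓ : Fin (h + h) → MvPolynomial (Fin (h + h)) ℂ, (∀ q, (ℓ q).totalDegree ≤ 1) ∧
        (Matrix.of fun i j : Fin r => coeff
          (∑ b ∈ u i, Finsupp.single (Fin.castAdd h b) 1 + ∑ d ∈ w j, Finsupp.single (Fin.natAdd h d) 1)
          (∏ q, ℓ q)).det ≠ 0 := by
  classical
  induction R with
  | zero =>
    intro h r hr u w hu hw
    exact chowHits_of_size_le_three h r (by omega) u w hu hw
  | succ R ih =>
    intro h r hr u w hu hw
    refine chow_hit_of_core_le (R + 1) ?_ h r hr u w hu hw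
    intro h' r' u' w' hr' hu' hw' hlk hpl hsz
    by_cases hedge : ∃ (a c : Fin h') (i₁ i₀ j₁ j₀ : Fin r'), i₁ ≠ i₀ ∧ u' i₀ = (u' i₁).erase a ∧
        j₁ ≠ j₀ ∧ w' j₀ = (w' j₁).erase c ∧ Set.InjOn (fun i => (u' i).erase a) {i | i ≠ i₁} ∧
        Set.InjOn (fun j => (w' j).erase c) {j | j ≠ j₁}
    · -- an edge step
      obtain ⟨a, c, i₁, i₀, j₁, j₀, hi, hi₀, hj, hj₀, hinju, hinjw⟩ := hedge
      obtain ⟨h'', rfl⟩ : ∃ h'', h' = h'' + 1 := ⟨h' - 1, by have := a.pos; omega⟩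
      obtain ⟨r'', rfl⟩ : ∃ r'', r' = r'' + 1 := ⟨r' - 1, by have := i₁.pos; omega⟩
      exact chow_edgeStep a c u' w' i₁ i₀ j₁ j₀ hi (mem_of_edge u' hu' hi hi₀) hi₀ hj
        (mem_of_edge w' hw' hj hj₀) hj₀
        (ih h'' r'' (by omega) _ _ (preimage_succAbove_injective_of_injOn a u' i₁ hinju)
          (preimage_succAbove_injective_of_injOn c w' j₁ hinjw))
    by_cases hrow : ∃ (a c : Fin h') (i₁ j₁ j₀ : Fin r'), (∀ i, i ≠ i₁ → (a ∈ u' i ↔ a ∉ u' i₁)) ∧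
        j₁ ≠ j₀ ∧ w' j₀ = (w' j₁).erase c ∧ Set.InjOn (fun j => (w' j).erase c) {j | j ≠ j₁}
    · -- a leaf step on the row side
      obtain ⟨a, c, i₁, j₁, j₀, hlone, hj, hj₀, hinj⟩ := hrow
      obtain ⟨h'', rfl⟩ : ∃ h'', h' = h'' + 1 := ⟨h' - 1, by have := a.pos; omega⟩
      obtain ⟨r'', rfl⟩ : ∃ r'', r' = r'' + 1 := ⟨r' - 1, by have := i₁.pos; omega⟩
      exact chow_leafStep a c u' w' i₁ j₁ j₀ hlone hj (mem_of_edge w' hw' hj hj₀) hj₀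
        (ih h'' r'' (by omega) _ _ (preimage_succAbove_injective_of_lonely a u' hu' i₁ hlone)
          (preimage_succAbove_injective_of_injOn c w' j₁ hinj))
    by_cases hcol : ∃ (c a : Fin h') (j₁ i₁ i₀ : Fin r'), (∀ j, j ≠ j₁ → (c ∈ w' j ↔ c ∉ w' j₁)) ∧
        i₁ ≠ i₀ ∧ u' i₀ = (u' i₁).erase a ∧ Set.InjOn (fun i => (u' i).erase a) {i | i ≠ i₁}
    · -- a leaf step on the column side
      obtain ⟨c, a, j₁, i₁, i₀, hlone, hi, hi₀, hinj⟩ := hcol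
      obtain ⟨h'', rfl⟩ : ∃ h'', h' = h'' + 1 := ⟨h' - 1, by have := a.pos; omega⟩
      obtain ⟨r'', rfl⟩ : ∃ r'', r' = r'' + 1 := ⟨r' - 1, by have := i₁.pos; omega⟩
      refine chow_hit_swap u' w' ?_
      exact chow_leafStep c a w' u' j₁ i₁ i₀ hlone hi (mem_of_edge u' hu' hi hi₀) hi₀
        (ih h'' r'' (by omega) _ _ (preimage_succAbove_injective_of_lonely c w' hw' j₁ hlone)
          (preimage_succAbove_injective_of_injOn a u' i₁ hinj))
    -- no step available: an edge-core
    push Not at hedge hrow hcol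
    exact core h' r' u' w' hu' hw' hlk hpl hsz
      (fun a c i₁ j₁ j₀ hlone hj hj₀ => hrow a c i₁ j₁ j₀ hlone hj hj₀)
      (fun c a j₁ i₁ i₀ hlone hi hi₀ => hcol c a j₁ i₁ i₀ hlone hi hi₀)
      (fun a c i₁ i₀ j₁ j₀ hi hi₀ hj hj₀ hboth =>
        hedge a c i₁ i₀ j₁ j₀ hi hi₀ hj hj₀ hboth.1 hboth.2)

/-- **EDGE-CORE ENGINE.**  If every injective layout `(u, w)` (height `h`, size `r`) that is LOCKED,
NOT PEELABLE at any pair of coordinates, of size `h + 1 ≤ r`, admits NO LEAF STEP on either side and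
NO EDGE STEP (no row coordinate with exactly one edge together with a column coordinate with exactly
one edge) is hit by a product of `h + h` affine forms, then every injective layout is hit. -/
theorem chow_hit_of_edgeCore
    (core : ∀ (h r : ℕ) (u w : Fin r → Finset (Fin h)), Function.Injective u → Function.Injective w →
      (∀ (a c : Fin h) (β γ : Bool),
        (Finset.univ.filter fun i => (a ∈ u i ↔ β = true)).card ≠
          (Finset.univ.filter fun j => (c ∈ w j ↔ γ = true)).card) →
      (∀ a c : Fin h, ¬ (Function.Injective (fun i => (u i).erase a) ∧
        Function.Injective (fun j => (w j).erase c))) →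
      h + 1 ≤ r →
      (∀ (a c : Fin h) (i₁ j₁ j₀ : Fin r), (∀ i, i ≠ i₁ → (a ∈ u i ↔ a ∉ u i₁)) → j₁ ≠ j₀ →
        w j₀ = (w j₁).erase c → ¬ Set.InjOn (fun j => (w j).erase c) {j | j ≠ j₁}) →
      (∀ (c a : Fin h) (j₁ i₁ i₀ : Fin r), (∀ j, j ≠ j₁ → (c ∈ w j ↔ c ∉ w j₁)) → i₁ ≠ i₀ →
        u i₀ = (u i₁).erase a → ¬ Set.InjOn (fun i => (u i).erase a) {i | i ≠ i₁}) →
      (∀ (a c : Fin h) (i₁ i₀ j₁ j₀ : Fin r), i₁ ≠ i₀ → u i₀ = (u i₁).erase a → j₁ ≠ j₀ →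
        w j₀ = (w j₁).erase c → ¬ (Set.InjOn (fun i => (u i).erase a) {i | i ≠ i₁} ∧
          Set.InjOn (fun j => (w j).erase c) {j | j ≠ j₁})) →
      ∃ ℓ : Fin (h + h) → MvPolynomial (Fin (h + h)) ℂ, (∀ q, (ℓ q).totalDegree ≤ 1) ∧
        (Matrix.of fun i j : Fin r => coeff
          (∑ b ∈ u i, Finsupp.single (Fin.castAdd h b) 1 + ∑ d ∈ w j, Finsupp.single (Fin.natAdd h d) 1)
          (∏ q, ℓ q)).det ≠ 0)
    (h r : ℕ) (u w : Fin r → Finset (Fin h)) (hu : Function.Injective u)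
    (hw : Function.Injective w) :
    ∃ ℓ : Fin (h + h) → MvPolynomial (Fin (h + h)) ℂ, (∀ q, (ℓ q).totalDegree ≤ 1) ∧
      (Matrix.of fun i j : Fin r => coeff
        (∑ b ∈ u i, Finsupp.single (Fin.castAdd h b) 1 + ∑ d ∈ w j, Finsupp.single (Fin.natAdd h d) 1)
        (∏ q, ℓ q)).det ≠ 0 :=
  chow_hit_of_edgeCore_le core r h r le_rfl u w hu hw

/-- **Contrapositive: the structure of a minimal missed layout, sharpened once more.**  If some
injective layout is NOT hit by any product of `h + h` affine forms, then some injective layout that is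
locked, unpeelable at every pair of coordinates, of size `r ≥ h + 1`, admits no leaf step on either
side AND no edge step, is not hit either. -/
theorem exists_edgeCore_of_not_hit {h r : ℕ} (u w : Fin r → Finset (Fin h))
    (hu : Function.Injective u) (hw : Function.Injective w)
    (hnot : ¬ ∃ ℓ : Fin (h + h) → MvPolynomial (Fin (h + h)) ℂ, (∀ q, (ℓ q).totalDegree ≤ 1) ∧
      (Matrix.of fun i j : Fin r => coeff
        (∑ b ∈ u i, Finsupp.single (Fin.castAdd h b) 1 + ∑ d ∈ w j, Finsupp.single (Fin.natAdd h d) 1)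
        (∏ q, ℓ q)).det ≠ 0) :
    ∃ (h' r' : ℕ) (u' w' : Fin r' → Finset (Fin h')), Function.Injective u' ∧ Function.Injective w' ∧
      (∀ (a c : Fin h') (β γ : Bool),
        (Finset.univ.filter fun i => (a ∈ u' i ↔ β = true)).card ≠
          (Finset.univ.filter fun j => (c ∈ w' j ↔ γ = true)).card) ∧
      (∀ a c : Fin h', ¬ (Function.Injective (fun i => (u' i).erase a) ∧
        Function.Injective (fun j => (w' j).erase c))) ∧
      h' + 1 ≤ r' ∧
      (∀ (a c : Fin h') (i₁ j₁ j₀ : Fin r'), (∀ i, i ≠ i₁ → (a ∈ u' i ↔ a ∉ u' i₁)) → j₁ ≠ j₀ →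
        w' j₀ = (w' j₁).erase c → ¬ Set.InjOn (fun j => (w' j).erase c) {j | j ≠ j₁}) ∧
      (∀ (c a : Fin h') (j₁ i₁ i₀ : Fin r'), (∀ j, j ≠ j₁ → (c ∈ w' j ↔ c ∉ w' j₁)) → i₁ ≠ i₀ →
        u' i₀ = (u' i₁).erase a → ¬ Set.InjOn (fun i => (u' i).erase a) {i | i ≠ i₁}) ∧
      (∀ (a c : Fin h') (i₁ i₀ j₁ j₀ : Fin r'), i₁ ≠ i₀ → u' i₀ = (u' i₁).erase a → j₁ ≠ j₀ →
        w' j₀ = (w' j₁).erase c → ¬ (Set.InjOn (fun i => (u' i).erase a) {i | i ≠ i₁} ∧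
          Set.InjOn (fun j => (w' j).erase c) {j | j ≠ j₁})) ∧
      ¬ ∃ ℓ : Fin (h' + h') → MvPolynomial (Fin (h' + h')) ℂ, (∀ q, (ℓ q).totalDegree ≤ 1) ∧
        (Matrix.of fun i j : Fin r' => coeff
          (∑ b ∈ u' i, Finsupp.single (Fin.castAdd h' b) 1 + ∑ d ∈ w' j, Finsupp.single (Fin.natAdd h' d) 1)
          (∏ q, ℓ q)).det ≠ 0 := by
  by_contra hall
  push Not at hall
  exact hnot (chow_hit_of_edgeCore
    (fun h r u w hu hw hlk hpl hsz hrow hcol hedge =>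
      hall h r u w hu hw hlk (fun a c h1 h2 => hpl a c ⟨h1, h2⟩) hsz hrow hcol
        (fun a c i₁ i₀ j₁ j₀ hi hi₀ hj hj₀ h1 h2 => hedge a c i₁ i₀ j₁ j₀ hi hi₀ hj hj₀ ⟨h1, h2⟩))
    h r u w hu hw)

end

end Summit.ValiantsHypothesis.ValiantsHypothesis.Theorems.BarrierLever.ChowFactor
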